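import Literature.AlgebraicGeometry.Resolution.LinearSectionsCharts
import Literature.AlgebraicGeometry.Resolution.BertiniIterated
import Literature.AlgebraicGeometry.Motives.CartierDivisor
import HarnessLib

/-!
# Jets of linear forms at a point of a closed subscheme of `ℙ^N_k`

Topic: `Literature/AlgebraicGeometry/Resolution`. For `ι : X ↪ ℙ^N_k` a closed immersion over
an algebraically closed field, a closed point `z` in the chart `h`, and an ideal
`J ⊆ 𝒪_{X,z}` (the stalk of the ideal of a closed subscheme `Z ∋ z`), the **jet** of a linear
form `b` is the class of `(Σ b_l x_l)/x_h` in `𝒪_{X,z}/(J + 𝔪_z²) = 𝒪_{Z,z}/𝔪²_{Z,z}`: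

* `LinSec.JetQuot ι h z hz J` — the `k`-algebra `𝒪_{X,z}/(J + 𝔪_z²)` (constants through the
  chart ring `Γ(chart h, 𝒪_X)`), and the `k`-linear `LinSec.jetMap : k^{N+1} → JetQuot`;
* `LinSec.jetMap_surjective` — **the jets of linear forms fill `𝒪_{Z,z}/𝔪²`** (the affine
  coordinates generate the chart ring; `z` closed);
* `LinSec.isGeneric_jetMap_notMem` — hence **a generic linear form has its jet outside any
  given proper subspace** (used to choose `t₀, …, t_d` with independent differentials at one
  point of each component of `Z`: de Jong 1996, proof of 4.11, "`Z → π(Z) → ℙ^{d-1}` is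
  generically étale by construction", i.e. 2.11 (β)).

Everything is proved; no named facts.

## References

* A. J. de Jong, *Smoothness, semi-stability and alterations*, Publ. Math. IHÉS 83 (1996), 2.11
  and proof of 4.11 (p. 68). [DeJong1996]
* R. Hartshorne, *Algebraic Geometry* (1977), II Thm. 8.18 (proof: separation of tangent
  vectors by the linear system). [Hartshorne1977]
-/

noncomputable section

open CategoryTheory AlgebraicGeometry TopologicalSpace Opposite IsLocalRing
open Literature.AlgebraicGeometry.Morphisms.ProjCech (grading PP)
open Literature.AlgebraicGeometry.Motives
open Literature.AlgebraicGeometry.Motives.ProjFrac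

attribute [local instance] MvPolynomial.gradedAlgebra
  Literature.AlgebraicGeometry.Motives.ProjBaseChange.algebraBase

namespace Literature.AlgebraicGeometry.Resolution

universe u

namespace BertiniAffine

/-- `𝔭² ≤ ((𝔭 S)²) ∩ A` for any `A`-algebra `S`. [folklore] -/
theorem sq_le_comap_map_sq' {A : Type*} [CommRing A] (𝔭 : Ideal A) (S : Type*) [CommRing S]
    [Algebra A S] : 𝔭 ^ 2 ≤ ((𝔭.map (algebraMap A S)) ^ 2).comap (algebraMap A S) := by
  rw [← Ideal.map_pow]; exact Ideal.le_comap_map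

/-- **`A ⧸ 𝔭² → S ⧸ (𝔭 S)²` is surjective for `S` the localisation at a MAXIMAL ideal `𝔭`**
(elements of `A ∖ 𝔭` are units modulo `𝔭²`). [folklore] -/
theorem quotient_sq_map_atPrime_surjective {A : Type*} [CommRing A] (𝔭 : Ideal A) [𝔭.IsMaximal]
    (S : Type*) [CommRing S] [Algebra A S] [IsLocalization.AtPrime S 𝔭] :
    Function.Surjective (Ideal.quotientMap ((𝔭.map (algebraMap A S)) ^ 2) (algebraMap A S)
      (sq_le_comap_map_sq' 𝔭 S)) := by
  let 𝔫 := 𝔭.map (algebraMap A S)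
  let θ := Ideal.quotientMap (𝔫 ^ 2) (algebraMap A S) (sq_le_comap_map_sq' 𝔭 S)
  have hθ : ∀ a : A, θ (Ideal.Quotient.mk _ a) = Ideal.Quotient.mk _ (algebraMap A S a) :=
    fun a => Ideal.quotientMap_mk
  -- elements outside `𝔭` are units modulo `𝔭²`
  have hunit : ∀ s : A, s ∉ 𝔭 → IsUnit (Ideal.Quotient.mk (𝔭 ^ 2) s) := by
    intro s hs
    by_contra hng
    obtain ⟨M, hM, hgM⟩ := exists_max_ideal_of_mem_nonunits hng
    have hmax : (M.comap (Ideal.Quotient.mk (𝔭 ^ 2))).IsMaximal :=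
      Ideal.comap_isMaximal_of_surjective _ Ideal.Quotient.mk_surjective
    have hM' : M.comap (Ideal.Quotient.mk (𝔭 ^ 2)) = 𝔭 := by
      refine ((inferInstance : 𝔭.IsMaximal).eq_of_le hmax.ne_top ?_).symm
      intro m hm
      have hsq : 𝔭 ^ 2 ≤ M.comap (Ideal.Quotient.mk (𝔭 ^ 2)) := fun x hx => by
        rw [Ideal.mem_comap, Ideal.Quotient.eq_zero_iff_mem.2 hx]; exact zero_mem _
      have hrad : 𝔭 ≤ (M.comap (Ideal.Quotient.mk (𝔭 ^ 2))).radical := fun x hx =>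
        ⟨2, hsq (Ideal.pow_mem_pow hx 2)⟩
      rw [Ideal.IsPrime.radical (Ideal.comap_isPrime _ _)] at hrad
      exact hrad hm
    apply hs
    rw [← hM', Ideal.mem_comap]
    exact hgM
  intro y
  obtain ⟨y, rfl⟩ := Ideal.Quotient.mk_surjective y
  obtain ⟨a, s, rfl⟩ := IsLocalization.exists_mk'_eq 𝔭.primeCompl y
  obtain ⟨b, hb⟩ := (hunit s.1 s.2).exists_right_inv
  obtain ⟨b, rfl⟩ := Ideal.Quotient.mk_surjective b
  refine ⟨Ideal.Quotient.mk _ (a * b), ?_⟩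
  have hsb : Ideal.Quotient.mk (𝔫 ^ 2) (algebraMap A S s.1) *
      Ideal.Quotient.mk (𝔫 ^ 2) (algebraMap A S b) = 1 := by
    have := congrArg (fun q => θ q) hb
    simp only [map_mul, map_one, hθ] at this
    exact this
  have hmk : IsLocalization.mk' S a s * algebraMap A S s.1 = algebraMap A S a :=
    IsLocalization.mk'_spec S a s
  change θ _ = _
  rw [hθ, map_mul, map_mul, ← hmk, map_mul, mul_assoc, hsb, mul_one]

end BertiniAffine

namespace LinSec

open BertiniAffine Literature.AlgebraicGeometry.Motives.RatFn

variable {k : Type u} [Field k] {N : ℕ} {X : Scheme.{u}} [X.Over (Spec (.of k))]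
  (ι : X ⟶ PP k N)
  (hι : ι ≫ Literature.AlgebraicGeometry.Morphisms.ProjCech.toSpec k N = X ↘ Spec (.of k))
  (h : Fin (N + 1)) (z : X) (hz : z ∈ chart ι h) (J : Ideal (X.presheaf.stalk z))

attribute [local instance] chartAlgebra

include hι in
/-- **The chart constants are the scheme constants**: the germ at `z` of the constant function
`c` of the chart ring `Γ(chart h, 𝒪_X)` is the structure constant `c ∈ 𝒪_{X,z}` of the
`k`-scheme `X` (`Motives.RatFn.algebraStalk`). [folklore] -/
theorem germ_algebraMap_chart (c : k) :
    (X.presheaf.germ (chart ι h) z hz).hom (algebraMap k Γ(X, chart ι h) c) =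
      algebraMap k (X.presheaf.stalk z) c := by
  rw [algebraMap_chart_apply, evalAway_algebraMap ι (X_mem h) one_pos, hι, algebraMap_stalk_apply]
  exact (TopCat.Presheaf.germ_res_apply X.presheaf (homOfLE le_top) z hz _)

/-- The class in `𝒪_{X,z}/(J + 𝔪_z²)` of the germ of a section of the chart: a ring
homomorphism `Γ(chart h, 𝒪_X) → 𝒪_{X,z}/(J + 𝔪_z²)`. [folklore] -/
def jetOf : Γ(X, chart ι h) →+* X.presheaf.stalk z ⧸ (J ⊔ maximalIdeal (X.presheaf.stalk z) ^ 2) :=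
  (Ideal.Quotient.mk (J ⊔ maximalIdeal (X.presheaf.stalk z) ^ 2)).comp
    (X.presheaf.germ (chart ι h) z hz).hom

include hι in
/-- `jetOf` commutes with constants. [folklore] -/
theorem jetOf_algebraMap (c : k) :
    jetOf ι h z hz J (algebraMap k Γ(X, chart ι h) c) = algebraMap k _ c := by
  rw [jetOf, RingHom.comp_apply, germ_algebraMap_chart ι hι h z hz]
  rfl

/-- **The jet map `b ↦` class of `(Σ b_l x_l)/x_h` in `𝒪_{X,z}/(J + 𝔪_z²)`** (for `J` the stalk
of the ideal of a closed subscheme `Z ∋ z` this is `𝒪_{Z,z}/𝔪²_{Z,z}`), a `k`-linear map.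
[folklore] -/
def jetMap : (Fin (N + 1) → k) →ₗ[k] X.presheaf.stalk z ⧸ (J ⊔ maximalIdeal (X.presheaf.stalk z) ^ 2) where
  toFun b := jetOf ι h z hz J (linSec ι h b)
  map_add' b b' := by
    rw [linSec_eq_sum, linSec_eq_sum, linSec_eq_sum, ← map_add, ← Finset.sum_add_distrib]
    congr 1
    refine Finset.sum_congr rfl fun l _ => ?_
    rw [Pi.add_apply, add_smul]
  map_smul' c b := by
    have e : linSec ι h (c • b) = c • linSec ι h b := by
      rw [linSec_eq_sum, linSec_eq_sum, Finset.smul_sum]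
      refine Finset.sum_congr rfl fun l _ => ?_
      rw [Pi.smul_apply, smul_eq_mul, mul_smul]
    rw [e, RingHom.id_apply, Algebra.smul_def, map_mul, jetOf_algebraMap ι hι h z hz J,
      ← Algebra.smul_def]

/-- `jetMap` unfolded. [folklore] -/
theorem jetMap_apply (b : Fin (N + 1) → k) :
    jetMap ι hι h z hz J b = jetOf ι h z hz J (linSec ι h b) := rfl

variable [IsAffineHom ι]

omit [X.Over (Spec (.of k))] in
/-- `𝔭_z² ↦` into `J + 𝔪_z²`. [folklore] -/
theorem ptIdeal_sq_le_comap :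
    ptIdeal ι h z hz ^ 2 ≤ (J ⊔ maximalIdeal (X.presheaf.stalk z) ^ 2).comap
      (X.presheaf.germ (chart ι h) z hz).hom := by
  have h1 : ptIdeal ι h z hz ≤ (maximalIdeal (X.presheaf.stalk z)).comap
      (X.presheaf.germ (chart ι h) z hz).hom := fun s hs => by
    rw [Ideal.mem_comap, mem_maximalIdeal, mem_nonunits_iff]
    exact (mem_ptIdeal_iff ι h hz s).mp hs
  calc ptIdeal ι h z hz ^ 2
      ≤ ((maximalIdeal (X.presheaf.stalk z)).comap (X.presheaf.germ (chart ι h) z hz).hom) ^ 2 :=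
        Ideal.pow_right_mono h1 2
    _ ≤ ((maximalIdeal (X.presheaf.stalk z)) ^ 2).comap (X.presheaf.germ (chart ι h) z hz).hom :=
        Ideal.le_comap_pow _ 2
    _ ≤ _ := Ideal.comap_mono le_sup_right

/-- The factorisation of `jetMap` through `t ↦ Σ t_l (x_l/x_h) mod 𝔭_z²`
(`BertiniAffine.linCombQuotSq`) and `Γ(chart h)/𝔭_z² → 𝒪_{X,z}/(J + 𝔪_z²)`. [folklore] -/
theorem jetMap_eq_quotientMap_linCombQuotSq (b : Fin (N + 1) → k) :
    jetMap ι hι h z hz J b = Ideal.quotientMap _ (X.presheaf.germ (chart ι h) z hz).hom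
      (ptIdeal_sq_le_comap ι h z hz J) (linCombQuotSq (k := k) (coordSec ι h) (ptIdeal ι h z hz) b) := by
  rw [linCombQuotSq_apply, Ideal.quotientMap_mk, jetMap_apply, linComb, linSec_eq_sum]
  rfl

/-- **Jets of linear forms fill `𝒪_{X,z}/(J + 𝔪_z²)`** for a closed point `z` (`ι` a closed
immersion, `k` algebraically closed): `Γ(chart h)/𝔭_z² → 𝒪_{X,z}/𝔪_z²` is onto (`z` closed) and
the affine coordinates separate tangent vectors. [folklore] -/
theorem jetMap_surjective [IsAlgClosed k] [IsClosedImmersion ι] (hzc : IsClosed ({z} : Set X)) :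
    Function.Surjective (jetMap ι hι h z hz J) := by
  haveI := ptIdeal_isMaximal ι h hz hzc
  haveI := finiteType_chart ι h
  have h1 : Function.Surjective (linCombQuotSq (k := k) (coordSec ι h) (ptIdeal ι h z hz)) :=
    surjective_linCombQuotSq_of_adjoin_eq_top (coordSec ι h) (adjoin_coordSec_eq_top ι h)
      (coordSec_self ι h) _
  -- `Γ(chart h)/𝔭² → 𝒪_{X,z}/𝔪_z²` is onto
  letI := (X.presheaf.germ (chart ι h) z hz).hom.toAlgebra
  haveI := isLocalization_stalk ι h z hz
  have h2 := quotient_sq_map_atPrime_surjective (ptIdeal ι h z hz) (X.presheaf.stalk z)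
  have hmax : (ptIdeal ι h z hz).map (algebraMap Γ(X, chart ι h) (X.presheaf.stalk z)) =
      maximalIdeal (X.presheaf.stalk z) :=
    IsLocalization.AtPrime.map_eq_maximalIdeal (ptIdeal ι h z hz) (X.presheaf.stalk z)
  have hle : (maximalIdeal (X.presheaf.stalk z)) ^ 2 ≤ J ⊔ maximalIdeal (X.presheaf.stalk z) ^ 2 :=
    le_sup_right
  intro v
  obtain ⟨v, rfl⟩ := Ideal.Quotient.mk_surjective v
  obtain ⟨w, hw⟩ := h2 (Ideal.Quotient.mk _ v)
  obtain ⟨w, rfl⟩ := Ideal.Quotient.mk_surjective w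
  obtain ⟨b, hb⟩ := h1 (Ideal.Quotient.mk _ w)
  refine ⟨b, ?_⟩
  rw [jetMap_eq_quotientMap_linCombQuotSq, hb, Ideal.quotientMap_mk]
  rw [Ideal.quotientMap_mk] at hw
  -- `germ w ≡ v` modulo `𝔪_z²`, hence modulo `J + 𝔪_z²`
  have hw' : (X.presheaf.germ (chart ι h) z hz).hom w - v ∈ (maximalIdeal (X.presheaf.stalk z)) ^ 2 := by
    rw [← hmax]
    exact (Ideal.Quotient.mk_eq_mk_iff_sub_mem _ _).mp hw
  exact (Ideal.Quotient.mk_eq_mk_iff_sub_mem _ _).mpr (hle hw')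

/-- **A generic linear form has its jet outside a given proper subspace of
`𝒪_{X,z}/(J + 𝔪_z²)`** (`z` closed). [cite: DeJong1996, 2.11] -/
theorem isGeneric_jetMap_notMem [IsAlgClosed k] [IsClosedImmersion ι] (hzc : IsClosed ({z} : Set X))
    (W : Submodule k (X.presheaf.stalk z ⧸ (J ⊔ maximalIdeal (X.presheaf.stalk z) ^ 2))) (hW : W ≠ ⊤) :
    IsGeneric fun b : Fin (N + 1) → k => jetMap ι hι h z hz J b ∉ W := by
  classical
  exact isGeneric_apply_notMem (jetMap ι hι h z hz J) (jetMap_surjective ι hι h z hz J hzc) W hW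

end LinSec

end Literature.AlgebraicGeometry.Resolution

end
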